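import Summits.QuantumAdvantage.AdviceFreeQNC0.CubeTwoReparam
import HarnessLib

/-!
# Cell qa-qnc0 (rung F-Q1, route RingFrame, crux α, line `product`): rooted 3-cubes with all seven
# proper vertices in a dense subset of a Hamming-weight class mod 3 (`CubeCover` at `D = 2`)

Planner qa-qnc0-p1's ROUND-8 reading of the degree-1 model theorem generalises it along the
**degree** axis by derivatives (TARGET §21, `Sketch9.lean` §21.1, asks P7(a)–(d)): if the far set
`far_D(Γ, θ)` of a cube-closed menu is non-empty, the cube identity
`Σ_{∅ ≠ S ⊆ [D+1]} γ(x + a_S) = (−1)^D γ(x)` (`deg γ ≤ D`) places one of the `2^{D+1} − 1` proper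
vertices of every `(D+1)`-cube rooted at a far point in `far_D(Γ, θ/(2^{D+1} − 1))`; so a
`(2^{D+1} − 1)`-**cube cover** of dense subsets of the weight classes `cls_r = {u : |u| ≡ r (3)}`
(`CubeCover D η`: every `A` with `(2^{D+1} − 1)·#(cls_r ∖ A) ≤ (1 − η)·#cls_r` contains, for EVERY
root `x ∈ {0,1}^L`, all proper vertices `x + a_S` of some `(D+1)`-cube) gives the far-set-empty
dichotomy `FSBDeg D c η` and hence `LDMAvia` at `τ ≥ Q^{−C}` for constant `D` (P7(c)).  The case
`D = 1` (three points `p₁, p₂, p₁ ⊕ p₂ ⊕ x`) is `three_xor_cover_of_dense_weightClass`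
(`WeightClassSumsets.lean`).  THIS FILE proves the case **`D = 2`** (ask P7(b) at `D = 2`):

* `cube_cover_of_dense_weightClass` — for `L ≥ 2`, `η·(8/7)^L ≥ 70000` and ANY
  `A ⊆ {0,1}^L` with `7·#(cls_r ∖ A) ≤ (1 − η)·#cls_r`, every `x` admits `p₁, p₂, p₃ ∈ A` with
  `p₁⊕p₂⊕x, p₁⊕x⊕p₃, p₂⊕x⊕p₃, p₁⊕p₂⊕p₃ ∈ A` (the seven proper vertices of the 3-cube at `x`
  spanned by `x⊕p₁, x⊕p₂, x⊕p₃`); `cube_cover_of_dense_weightClass_eventually` — the `∃ L₀ ∀ L ≥ L₀`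
  form for every `η > 0`;
* `cubeCoverAt_two_of_dense_weightClass`, `cubeCover_two_of_dense_weightClass` — the same in the
  planner's `cubeVertex` vocabulary (`CubeCoverAt L 2 η` / `CubeCover 2 η` of Sketch9 §21.1, with
  `cls L r` unfolded to the filter — equal by `rfl` — and WITHOUT the hypothesis `A ⊆ cls L r`,
  which turns out to be unnecessary).

## The proof (second moment over two free vectors, characters of `ℤ/3`)

All eight counts that occur — the number `N(x)` of rooted cubes with all seven proper vertices in
the class, and the seven numbers of such cubes whose `k`-th vertex lies in the bad set
`B = cls_r ∖ A` — reduce, after a re-parametrisation of the cube by an xor-translation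
(`sum_comp_xorLeft`), to ONE two-vector count
`P(x, y) = #{(q₁, q₂) : q₁, q₂, q₁⊕q₂⊕x, q₁⊕x⊕y, q₂⊕x⊕y, q₁⊕q₂⊕y ∈ cls_r}`:
`N(x) = Σ_{y ∈ cls_r} P(x, y)` and each bad count equals `Σ_{w ∈ B} P(x, w)`
(`cubeCount_eq_sum_pairCount`, `badCount_*_eq`).  Writing the six residue conditions with the
characters of `ℤ/3` (`three_mul_ite_mod_eq_sum_omega3_pow`) gives the product formula
`3⁶·P(x,y) = Σ_{t ∈ (ℤ/3)⁶} ω^{2r|t|} Π_j F_j(t)` (`three_pow_mul_count_eq`, stated for any family of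
vertex maps that act coordinatewise on a free vector of PAIRS of bits), each factor being a sum
of four cube roots of unity, so `|F_j| ≤ 4`, and `|F_j| ≤ 3` unless the four exponents agree mod 3
(`norm_sum_omega3_pow_le_three`).  A 729-case `decide` (`key6`) shows that for `t ≠ 0` the
exponents at coordinate `j` are non-constant either at every `j` with `x_j ≠ y_j` (when `t` is
"paired": `t₀+t₃ ≡ t₁+t₄ ≡ t₂+t₅ ≡ 0`) or at every `j` with `x_j = y_j` (otherwise); hence
`|729·P(x,y) − 4^L| ≤ 729·(E₁ + E₂)` with `E₁ = Π_j (3 if x_j ≠ y_j else 4)`,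
`E₂ = Π_j (4 if x_j ≠ y_j else 3)` and `Σ_y E₁ = Σ_y E₂ = 7^L` (`abs_pairCount_sub_le`, `sum_errA`,
`sum_errB`).  Summing, `#good cubes ≥ N − Σ bad ≥ (#cls_r − 7·#B)·4^L/729 − 16·7^L
≥ η·#cls_r·4^L/729 − 16·7^L ≥ η·8^L/4374 − 16·7^L > 0` as soon as `η·(8/7)^L ≥ 70000`
(`#cls_r ≥ 2^L/6` for `L ≥ 2`, `card_class_ge`).

WHAT THIS IS NOT: not `CubeCover D η` for `D ≥ 3` (the same second-moment method works for each
fixed `D` with a `3^{2^{D+1}−2}`-case check, not attempted here), not the cube identity P7(a), not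
the assembly P7(c)/(d), and nothing about `RingToElim` itself (OPEN).  Everything here is
elementary counting. [folklore]
-/
noncomputable section

namespace Summit.QuantumAdvantage.AdviceFreeQNC0

open Finset
open Literature.Computability.MetaComplexity.Hegedus

-- the machinery of the `D = 2` cube count lives in its own namespace `CubeTwo`.
namespace CubeTwo

variable {L : ℕ}

/-! ### The union bound over the bad vertex -/

/-- **Union bound.** If `B = S ∖ A`, a cube in `S` that is not in `A` has a vertex in `B`
(for any `A`; `A ⊆ S` is not needed). [folklore] -/
theorem cubeCount_le_add_bad (S A : Finset (Fin L → Bool)) (x : Fin L → Bool) :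
    cubeCount S x ≤ cubeCount A x +
      (badCount S (S \ A) x (fun p₁ _ _ => p₁) + badCount S (S \ A) x (fun _ p₂ _ => p₂) +
        badCount S (S \ A) x (fun _ _ p₃ => p₃) +
        badCount S (S \ A) x (fun p₁ p₂ _ => x3 p₁ p₂ x) +
        badCount S (S \ A) x (fun p₁ _ p₃ => x3 p₁ x p₃) +
        badCount S (S \ A) x (fun _ p₂ p₃ => x3 p₂ x p₃) +
        badCount S (S \ A) x (fun p₁ p₂ p₃ => x3 p₁ p₂ p₃)) := by
  unfold cubeCount badCount
  simp only [← Finset.sum_add_distrib]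
  refine Finset.sum_le_sum fun p₃ _ => Finset.sum_le_sum fun p₁ _ => Finset.sum_le_sum fun p₂ _ => ?_
  have hB : ∀ v, v ∈ S → v ∉ A → v ∈ S \ A := fun v hv hv' => Finset.mem_sdiff.2 ⟨hv, hv'⟩
  by_cases hS : p₃ ∈ S ∧ p₁ ∈ S ∧ p₂ ∈ S ∧ x3 p₁ p₂ x ∈ S ∧ x3 p₁ x p₃ ∈ S ∧ x3 p₂ x p₃ ∈ S ∧
      x3 p₁ p₂ p₃ ∈ S
  · rw [if_pos hS]
    obtain ⟨h3, h1, h2, h12, h13, h23, h123⟩ := hS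
    by_cases hA' : p₃ ∈ A ∧ p₁ ∈ A ∧ p₂ ∈ A ∧ x3 p₁ p₂ x ∈ A ∧ x3 p₁ x p₃ ∈ A ∧ x3 p₂ x p₃ ∈ A ∧
        x3 p₁ p₂ p₃ ∈ A
    · rw [if_pos hA']; omega
    · simp only [not_and_or] at hA'
      rcases hA' with h | h | h | h | h | h | h
      · rw [if_pos (show p₃ ∈ S \ A ∧ _ from ⟨hB _ h3 h, h3, h1, h2, h12, h13, h23, h123⟩)]; omega
      · rw [if_pos (show p₁ ∈ S \ A ∧ _ from ⟨hB _ h1 h, h3, h1, h2, h12, h13, h23, h123⟩)]; omega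
      · rw [if_pos (show p₂ ∈ S \ A ∧ _ from ⟨hB _ h2 h, h3, h1, h2, h12, h13, h23, h123⟩)]; omega
      · rw [if_pos (show x3 p₁ p₂ x ∈ S \ A ∧ _ from ⟨hB _ h12 h, h3, h1, h2, h12, h13, h23, h123⟩)]
        omega
      · rw [if_pos (show x3 p₁ x p₃ ∈ S \ A ∧ _ from ⟨hB _ h13 h, h3, h1, h2, h12, h13, h23, h123⟩)]
        omega
      · rw [if_pos (show x3 p₂ x p₃ ∈ S \ A ∧ _ from ⟨hB _ h23 h, h3, h1, h2, h12, h13, h23, h123⟩)]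
        omega
      · rw [if_pos (show x3 p₁ p₂ p₃ ∈ S \ A ∧ _ from ⟨hB _ h123 h, h3, h1, h2, h12, h13, h23, h123⟩)]
        omega
  · rw [if_neg hS]; exact Nat.zero_le _

/-! ### The class size and the main theorem -/

/-- `#cls_r ≥ 2^L/6` for `L ≥ 2`. [folklore] -/
theorem card_class_ge (hL : 2 ≤ L) (r : ℕ) :
    (2 : ℝ) ^ L / 6 ≤ ((univ.filter fun u : Fin L → Bool => wt u % 3 = r % 3).card : ℝ) := by
  have h3 := abs_three_mul_card_filter_mod_sub_card_le (univ : Finset (Fin L → Bool)) r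
  rw [norm_sum_omega3_pow_wt, Finset.card_univ, Fintype.card_fun, Fintype.card_bool,
    Fintype.card_fin] at h3
  push_cast at h3
  have e : (univ.filter fun u : Fin L → Bool =>
      Literature.Computability.MetaComplexity.Hegedus.wt u % 3 = r % 3) =
      (univ.filter fun u : Fin L → Bool => wt u % 3 = r % 3) := rfl
  rw [e, abs_le] at h3
  have h4 : (4 : ℝ) ≤ 2 ^ L := by
    calc (4 : ℝ) = 2 ^ 2 := by norm_num
      _ ≤ 2 ^ L := pow_le_pow_right₀ (by norm_num) hL
  linarith [h3.1]

/-- From a non-zero cube count, a cube. -/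
theorem exists_cube_of_cubeCount_ne_zero (A : Finset (Fin L → Bool)) (x : Fin L → Bool)
    (h : cubeCount A x ≠ 0) :
    ∃ p₁ ∈ A, ∃ p₂ ∈ A, ∃ p₃ ∈ A,
      x3 p₁ p₂ x ∈ A ∧ x3 p₁ x p₃ ∈ A ∧ x3 p₂ x p₃ ∈ A ∧ x3 p₁ p₂ p₃ ∈ A := by
  unfold cubeCount at h
  obtain ⟨p₃, -, h₃⟩ := Finset.exists_ne_zero_of_sum_ne_zero h
  obtain ⟨p₁, -, h₁⟩ := Finset.exists_ne_zero_of_sum_ne_zero h₃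
  obtain ⟨p₂, -, h₂⟩ := Finset.exists_ne_zero_of_sum_ne_zero h₁
  by_cases hc : p₃ ∈ A ∧ p₁ ∈ A ∧ p₂ ∈ A ∧ x3 p₁ p₂ x ∈ A ∧ x3 p₁ x p₃ ∈ A ∧ x3 p₂ x p₃ ∈ A ∧
      x3 p₁ p₂ p₃ ∈ A
  · obtain ⟨g3, g1, g2, g12, g13, g23, g123⟩ := hc
    exact ⟨p₁, g1, p₂, g2, p₃, g3, g12, g13, g23, g123⟩
  · exact (h₂ (if_neg hc)).elim

/-- **Rooted 3-cubes in a dense subset of a Hamming-weight class mod 3 (`CubeCover` at `D = 2`).**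
If `A` misses so few points of the class `cls_r := {u : |u| ≡ r (mod 3)}` that
`7·#(cls_r ∖ A) ≤ (1 − η)·#cls_r` (no hypothesis `A ⊆ cls_r` is needed), and `L` is large
(`L ≥ 2`, `η·(8/7)^L ≥ 70000`), then EVERY
`x ∈ {0,1}^L` is the base vertex of a 3-dimensional affine cube whose seven other vertices
`p₁, p₂, p₃, p₁⊕p₂⊕x, p₁⊕x⊕p₃, p₂⊕x⊕p₃, p₁⊕p₂⊕p₃` all lie in `A`.  The threshold `7 = 2³ − 1` is the
union-bound constant of planner qa-qnc0-p1's `CubeCover 2 η` (Sketch9 §21.1, ROUND-8 §1(b)); `D = 1`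
is `three_xor_cover_of_dense_weightClass`. [folklore] -/
theorem cube_cover_of_dense_weightClass (hL2 : 2 ≤ L) (r : ℕ) (A : Finset (Fin L → Bool)) (η : ℝ)
    (hB : (7 : ℝ) * (((univ.filter fun u : Fin L → Bool => wt u % 3 = r % 3) \ A).card : ℝ) ≤
      (1 - η) * ((univ.filter fun u : Fin L → Bool => wt u % 3 = r % 3).card : ℝ))
    (hL : (70000 : ℝ) ≤ η * (8 / 7 : ℝ) ^ L) (x : Fin L → Bool) :
    ∃ p₁ ∈ A, ∃ p₂ ∈ A, ∃ p₃ ∈ A,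
      x3 p₁ p₂ x ∈ A ∧ x3 p₁ x p₃ ∈ A ∧ x3 p₂ x p₃ ∈ A ∧ x3 p₁ p₂ p₃ ∈ A := by
  set S : Finset (Fin L → Bool) := univ.filter fun u : Fin L → Bool => wt u % 3 = r % 3 with hSdef
  have hS : ∀ u : Fin L → Bool, u ∈ S ↔ wt u % 3 = r % 3 := fun u => by
    rw [hSdef, Finset.mem_filter]; simp
  have hBS : S \ A ⊆ S := Finset.sdiff_subset
  apply exists_cube_of_cubeCount_ne_zero
  -- the counting inequality
  have hU := cubeCount_le_add_bad S A x
  rw [cubeCount_eq_sum_pairCount hS, badCount_p1_eq hS hBS, badCount_p2_eq hS hBS,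
    badCount_p3_eq hS hBS, badCount_v12_eq hS hBS, badCount_v13_eq hS hBS, badCount_v23_eq hS hBS,
    badCount_v123_eq hS hBS] at hU
  have hUr : (∑ y ∈ S, (pairCount x y r : ℝ)) ≤
      (cubeCount A x : ℝ) + 7 * ∑ w ∈ S \ A, (pairCount x w r : ℝ) := by
    have h' : ((∑ y ∈ S, pairCount x y r : ℕ) : ℝ) ≤
        ((cubeCount A x + (∑ w ∈ S \ A, pairCount x w r + ∑ w ∈ S \ A, pairCount x w r +
          ∑ w ∈ S \ A, pairCount x w r + ∑ w ∈ S \ A, pairCount x w r +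
          ∑ w ∈ S \ A, pairCount x w r + ∑ w ∈ S \ A, pairCount x w r +
          ∑ w ∈ S \ A, pairCount x w r) : ℕ) : ℝ) := Nat.cast_le.mpr hU
    push_cast at h'
    linarith
  -- the two asymptotic estimates
  have hErr : ∑ y : Fin L → Bool, (errA x y + errB x y) = 2 * 7 ^ L := by
    rw [Finset.sum_add_distrib, sum_errA, sum_errB]; ring
  have hErrNonneg : ∀ y : Fin L → Bool, 0 ≤ errA x y + errB x y :=
    fun y => add_nonneg (errA_nonneg x y) (errB_nonneg x y)
  have hLow : (S.card : ℝ) * (4 ^ L / 729) - 2 * 7 ^ L ≤ ∑ y ∈ S, (pairCount x y r : ℝ) := by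
    have h1 : ∑ y ∈ S, ((4 : ℝ) ^ L / 729 - (errA x y + errB x y)) ≤ ∑ y ∈ S, (pairCount x y r : ℝ) :=
      Finset.sum_le_sum fun y _ => pairCount_ge x y r
    rw [Finset.sum_sub_distrib, Finset.sum_const, nsmul_eq_mul] at h1
    have h2 : ∑ y ∈ S, (errA x y + errB x y) ≤ ∑ y, (errA x y + errB x y) :=
      Finset.sum_le_sum_of_subset_of_nonneg (Finset.subset_univ S) fun y _ _ => hErrNonneg y
    linarith
  have hUpp : ∑ w ∈ S \ A, (pairCount x w r : ℝ) ≤ ((S \ A).card : ℝ) * (4 ^ L / 729) + 2 * 7 ^ L := by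
    have h1 : ∑ w ∈ S \ A, (pairCount x w r : ℝ) ≤
        ∑ w ∈ S \ A, ((4 : ℝ) ^ L / 729 + (errA x w + errB x w)) :=
      Finset.sum_le_sum fun w _ => pairCount_le x w r
    rw [Finset.sum_add_distrib, Finset.sum_const, nsmul_eq_mul] at h1
    have h2 : ∑ w ∈ S \ A, (errA x w + errB x w) ≤ ∑ y, (errA x y + errB x y) :=
      Finset.sum_le_sum_of_subset_of_nonneg (Finset.subset_univ _) fun y _ _ => hErrNonneg y
    linarith
  -- class size, positivity of η, growth hypothesis
  have hScard := card_class_ge hL2 r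
  rw [← hSdef] at hScard
  have h87 : (0 : ℝ) < (8 / 7 : ℝ) ^ L := by positivity
  have hη : 0 < η := by
    by_contra hle
    have : η * (8 / 7 : ℝ) ^ L ≤ 0 := mul_nonpos_of_nonpos_of_nonneg (not_lt.1 hle) h87.le
    linarith
  have h8 : η * (8 : ℝ) ^ L ≥ 70000 * 7 ^ L := by
    have e : (8 : ℝ) ^ L = (8 / 7 : ℝ) ^ L * 7 ^ L := by rw [← mul_pow]; norm_num
    rw [e, ← mul_assoc]
    exact mul_le_mul_of_nonneg_right hL (by positivity)
  have e8 : (8 : ℝ) ^ L = 2 ^ L * 4 ^ L := by rw [← mul_pow]; norm_num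
  have h4pos : (0 : ℝ) ≤ 4 ^ L := by positivity
  -- combine
  have hBr := mul_le_mul_of_nonneg_right hB h4pos        -- 7·#B·4^L ≤ (1−η)·#S·4^L
  have hSr := mul_le_mul_of_nonneg_right hScard (mul_nonneg hη.le h4pos) -- 2^L/6·(η4^L) ≤ #S·(η4^L)
  have hpos : (0 : ℝ) < (cubeCount A x : ℝ) := by
    nlinarith [hUr, hLow, hUpp, hBr, hSr, h8, e8, h4pos, pow_pos (by norm_num : (0:ℝ) < 7) L]
  have : (cubeCount A x : ℝ) ≠ 0 := ne_of_gt hpos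
  exact_mod_cast this

/-- The eventual form: for every `η > 0` there is `L₀` such that the conclusion holds for all
`L ≥ L₀` (planner's `CubeCover 2 η` over `cls L r`, up to unfolding `cls`). [folklore] -/
theorem cube_cover_of_dense_weightClass_eventually (η : ℝ) (hη : 0 < η) :
    ∃ L₀ : ℕ, ∀ L : ℕ, L₀ ≤ L → ∀ (r : ℕ) (A : Finset (Fin L → Bool)),
      (7 : ℝ) * (((univ.filter fun u : Fin L → Bool => wt u % 3 = r % 3) \ A).card : ℝ) ≤
        (1 - η) * ((univ.filter fun u : Fin L → Bool => wt u % 3 = r % 3).card : ℝ) →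
      ∀ x : Fin L → Bool, ∃ p₁ ∈ A, ∃ p₂ ∈ A, ∃ p₃ ∈ A,
        x3 p₁ p₂ x ∈ A ∧ x3 p₁ x p₃ ∈ A ∧ x3 p₂ x p₃ ∈ A ∧ x3 p₁ p₂ p₃ ∈ A := by
  obtain ⟨N, hN⟩ := pow_unbounded_of_one_lt (70000 / η) (by norm_num : (1 : ℝ) < 8 / 7)
  refine ⟨max 2 N, fun L hL r A hB x => ?_⟩
  have hL2 : 2 ≤ L := le_trans (le_max_left _ _) hL
  have hLN : N ≤ L := le_trans (le_max_right _ _) hL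
  refine cube_cover_of_dense_weightClass hL2 r A η hB ?_ x
  have hmono : (8 / 7 : ℝ) ^ N ≤ (8 / 7 : ℝ) ^ L := pow_le_pow_right₀ (by norm_num) hLN
  have h1 : 70000 / η < (8 / 7 : ℝ) ^ L := lt_of_lt_of_le hN hmono
  have h2 := (div_lt_iff₀ hη).1 h1
  linarith

/-! ### The planner's `cubeVertex` form (`CubeCoverAt L 2 η`, `CubeTransfer.lean` / Sketch9 §21.1) -/

/-- the seven non-empty subsets of `Fin 3`. [folklore] -/
theorem eq_of_nonempty_subset_fin_three (S : Finset (Fin 3)) (hS : S.Nonempty) :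
    S = {0} ∨ S = {1} ∨ S = {2} ∨ S = {0, 1} ∨ S = {0, 2} ∨ S = {1, 2} ∨ S = {0, 1, 2} := by
  have h : S ∈ (Finset.univ : Finset (Finset (Fin 3))) := Finset.mem_univ S
  fin_cases h
  · exact absurd hS (by decide)
  all_goals decide

/-- closed form of `cubeVertex` (of `CubeTransfer.lean`) for three generators, coordinatewise.
[folklore] -/
theorem cubeVertex_three_apply (x q₀ q₁ q₂ : Fin L → Bool) (S : Finset (Fin 3)) (ℓ : Fin L) :
    cubeVertex x ![q₀, q₁, q₂] S ℓ =
      xor (x ℓ) (xor (decide (0 ∈ S) && q₀ ℓ)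
        (xor (decide (1 ∈ S) && q₁ ℓ) (decide (2 ∈ S) && q₂ ℓ))) := by
  unfold cubeVertex
  have hfilter : (S.filter fun i => (![q₀, q₁, q₂] : Fin 3 → Fin L → Bool) i ℓ = true) =
      S.filter fun i => (![q₀ ℓ, q₁ ℓ, q₂ ℓ] : Fin 3 → Bool) i = true := by
    apply Finset.filter_congr
    intro i _
    fin_cases i <;> simp
  rw [hfilter]
  clear hfilter
  generalize x ℓ = bx
  generalize q₀ ℓ = b₀
  generalize q₁ ℓ = b₁
  generalize q₂ ℓ = b₂
  revert S bx b₀ b₁ b₂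
  decide

end CubeTwo

variable {L : ℕ}

/-- **`CubeCoverAt L 2 η`** (`CubeTransfer.lean`, verbatim the planner's Sketch9 §21.1(b)) at every
`L ≥ 2` with `η·(8/7)^L ≥ 70000`: if `(2³ − 1)·#(cls L r ∖ A) ≤ (1 − η)·#(cls L r)` then every `x`
has generators `a : Fin 3 → {0,1}^L` with `x + a_S ∈ A` for all `∅ ≠ S ⊆ [3]`.  (The hypothesis
`A ⊆ cls L r` of `CubeCoverAt` is not used.) [folklore] -/
theorem cubeCoverAt_two (hL2 : 2 ≤ L) (η : ℝ) (hL : (70000 : ℝ) ≤ η * (8 / 7 : ℝ) ^ L) :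
    CubeCoverAt L 2 η := by
  intro r A _ hB x
  have h7 : ((2 : ℝ) ^ (2 + 1) - 1) = 7 := by norm_num
  rw [h7] at hB
  obtain ⟨p₁, g1, p₂, g2, p₃, g3, g12, g13, g23, g123⟩ :=
    CubeTwo.cube_cover_of_dense_weightClass hL2 r A η hB hL x
  refine ⟨![fun ℓ => xor (x ℓ) (p₁ ℓ), fun ℓ => xor (x ℓ) (p₂ ℓ), fun ℓ => xor (x ℓ) (p₃ ℓ)], ?_⟩
  intro S hS
  have ev : ∀ T : Finset (Fin 3), cubeVertex x
      ![fun ℓ => xor (x ℓ) (p₁ ℓ), fun ℓ => xor (x ℓ) (p₂ ℓ), fun ℓ => xor (x ℓ) (p₃ ℓ)] T =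
      fun ℓ => xor (x ℓ) (xor (decide (0 ∈ T) && xor (x ℓ) (p₁ ℓ))
        (xor (decide (1 ∈ T) && xor (x ℓ) (p₂ ℓ)) (decide (2 ∈ T) && xor (x ℓ) (p₃ ℓ)))) :=
    fun T => funext fun ℓ => CubeTwo.cubeVertex_three_apply x _ _ _ T ℓ
  rw [ev]
  rcases CubeTwo.eq_of_nonempty_subset_fin_three S hS with rfl | rfl | rfl | rfl | rfl | rfl | rfl
  · convert g1 using 1
    funext ℓ; cases x ℓ <;> cases p₁ ℓ <;> cases p₂ ℓ <;> cases p₃ ℓ <;> decide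
  · convert g2 using 1
    funext ℓ; cases x ℓ <;> cases p₁ ℓ <;> cases p₂ ℓ <;> cases p₃ ℓ <;> decide
  · convert g3 using 1
    funext ℓ; cases x ℓ <;> cases p₁ ℓ <;> cases p₂ ℓ <;> cases p₃ ℓ <;> decide
  · convert g12 using 1
    funext ℓ; unfold CubeTwo.x3; cases x ℓ <;> cases p₁ ℓ <;> cases p₂ ℓ <;> cases p₃ ℓ <;> decide
  · convert g13 using 1
    funext ℓ; unfold CubeTwo.x3; cases x ℓ <;> cases p₁ ℓ <;> cases p₂ ℓ <;> cases p₃ ℓ <;> decide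
  · convert g23 using 1
    funext ℓ; unfold CubeTwo.x3; cases x ℓ <;> cases p₁ ℓ <;> cases p₂ ℓ <;> cases p₃ ℓ <;> decide
  · convert g123 using 1
    funext ℓ; unfold CubeTwo.x3; cases x ℓ <;> cases p₁ ℓ <;> cases p₂ ℓ <;> cases p₃ ℓ <;> decide

/-- **`CubeCover 2 η`** for every `η > 0` (T6(b) = P7(b) at `D = 2`). [folklore] -/
theorem cubeCover_two (η : ℝ) (hη : 0 < η) : CubeCover 2 η := by
  obtain ⟨N, hN⟩ := pow_unbounded_of_one_lt (70000 / η) (by norm_num : (1 : ℝ) < 8 / 7)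
  refine ⟨max 2 N, fun L hL => cubeCoverAt_two (le_trans (le_max_left _ _) hL) η ?_⟩
  have hLN : N ≤ L := le_trans (le_max_right _ _) hL
  have hmono : (8 / 7 : ℝ) ^ N ≤ (8 / 7 : ℝ) ^ L := pow_le_pow_right₀ (by norm_num) hLN
  have h1 : 70000 / η < (8 / 7 : ℝ) ^ L := lt_of_lt_of_le hN hmono
  have h2 := (div_lt_iff₀ hη).1 h1
  linarith

/-- Hence, by the prover's transfer `fsbDeg_of_cubeCover` (`CubeTransfer.lean`, T6(c)), far-set
balance at column degree `2` with the dual-distance constants, UNCONDITIONALLY: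
`∀ τ > 0, FSBDeg 2 2³ 2^{−6} τ 0`. [folklore] -/
theorem fsbDeg_two (τ : ℝ) (hτ : 0 < τ) :
    FSBDeg 2 ((2 : ℝ) ^ (2 + 1)) (1 / (2 : ℝ) ^ (2 + 4)) τ 0 :=
  fsbDeg_of_cubeCover 2 (cubeCover_two (1 / 2) (by norm_num)) τ hτ

end Summit.QuantumAdvantage.AdviceFreeQNC0

end
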